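import Literature.AlgebraicGeometry.AbelianSchemes.AbelianLiftObstructionClass
import Literature.AlgebraicGeometry.Motives.AbelianVarietyTangentSheafFree
import Literature.AlgebraicGeometry.Motives.AbelianVarietyGlobalOneFormsMulNHolds
import Literature.AlgebraicGeometry.Morphisms.CechModuleH2FrameCoordinates
import Literature.AlgebraicGeometry.HodgeTheory.HodgeSheafPullbackForms
import HarnessLib

/-!
# The inversion negates global vector fields: `θ|_{ι⁻¹W}(d(ι♯ c)) = −ι♯(θ|_W(d c))` on an abelian variety
# ([Oort1971] p. 279; [MumfordAV1970] §4 (iii)–(iv); [GortzWedhorn2023] Rem. 27.18 (3)–(4))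

Layer `Literature/AlgebraicGeometry/AbelianSchemes`; namespace `Literature.AlgebraicGeometry.AbelianSchemes.AbelianSchemeOver`.  PROOF file
(theorems only; no definition, no instance, no notation, no named fact, no `sorry`).  For an abelian scheme `B` over a field `k`
(e.g. the canonical closed fibre `X₀ ×_{A⧸J} κ(A)` of ★ (D) `AbelianLiftObstructionClass`), the inversion `ι = ι[B.X]` CONJUGATES every
GLOBAL vector field `θ ∈ Γ(B, 𝒯_{B/k})` to `−θ`, read in the `appLE θ (𝟙 _) (dSection …)` currency of ★ (vii)∕(D): on every open `W`,
`θ|_{ι⁻¹W}(d(ι♯ c)) = − ι♯(θ|_W(d c))` (head `appLE_dSection_app_inv_eq_neg`, statement = the boxed sigtwin 578be974c0cce924 of LA3-p01 (g5)).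

ROAD «forms, not fields» — everything runs on the `Ω¹` side, where the tree is complete:
* §1 `inv_eq_hom_neg_one_zsmul_one` — the carrier bridge `ι[B.X] = ((−1 : ℤ) • 𝟙 B.toAffine.toAbelianVariety).hom.hom.hom` (Mathlib
  `Hom.inv_def`, ★ `AbelianVariety.hom_zsmul_id`);
* §2 **`comap_inv_app_top ∕ _map` — `ι^♯ ω = −ω` for every GLOBAL `1`-form** (★ `AbelianVariety.comap_zsmul_one_app_top ∕ _map` at
  `n := −1`: global forms are determined by their value at the origin and `T_e^*([n]) = n`, [MumfordAV1970] §4 (iv)); `comap_inv_app_smul`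
  (`ι^♯` is `𝒪`-semilinear along `ι♯`, Mathlib `Scheme.Modules.Hom.app_smul`); `app_inv_constToPresheaf` (`ι♯` fixes the constants,
  ★ `appLE_constToPresheaf`);
* §3 plumbing for global fields: `appLE_map_top` (values of `θ` commute with restriction, ★ `appLE_map`), `exists_appLE_frameVec_eq_const`
  (`θ(ω)` is a CONSTANT for global `θ`, `ω`: `Γ(B, 𝒪_B) = k`, ★ `exists_constToPresheaf_app_top_eq`);
* §4 THE HEAD: write `d c = ∑ⱼ aⱼ • ωⱼ|_W` on the global coframe `ωⱼ` of `Ω¹_B ≅ 𝒪_B^{dim}` (★ `AbelianVariety.nonempty_cotangentSheaf_iso_free_fin`,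
  [MumfordAV1970] §4 (iii); coordinates by ★ `Morphisms.eq_sum_frameProj_smul_frameVec`), push through `d(ι♯ c) = ι^♯(d c)` (★ `comap_app_dSection`),
  §2 and §3: both sides equal `−∑ⱼ ι♯(aⱼ) · θ(ωⱼ)`.

Cell `hodgecm-mathlib` (D-0151), FLOOR 0 ∕ P6 (U)-road organ (O2) of the (U-ab) plate (LEAD «M-140a» (2)); generic (any abelian scheme over a field, any
characteristic), count-neutral — HC_CM is proved only modulo the 7 printed citations until rung 0 closes, and nothing here refers to it.

## References
* F. Oort, *Finite group schemes, local moduli for abelian varieties, and lifting problems*, Compositio Math. 23 (1971), §2.2 (pp. 277–280).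
  [Oort1971]
* D. Mumford, *Abelian Varieties* (1970), §4 (iii)–(iv) (pp. 42–43). [MumfordAV1970]
* U. Görtz, T. Wedhorn, *Algebraic Geometry II* (2023), Rem. 27.18 (3)–(4). [GortzWedhorn2023]
-/

noncomputable section

set_option backward.isDefEq.respectTransparency false

open CategoryTheory CategoryTheory.Limits AlgebraicGeometry TopologicalSpace Opposite MonObj
open Literature.AlgebraicGeometry.Morphisms Literature.AlgebraicGeometry.HodgeTheory Literature.AlgebraicGeometry.Modules
  Literature.AlgebraicGeometry.Motives

namespace Literature.AlgebraicGeometry.AbelianSchemes.AbelianSchemeOver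

variable {k : Type} [Field k] (B : AbelianSchemeOver (Spec (.of k)))

/-! ## §1 The carrier bridge `ι = (−1) • 𝟙` -/

/-- **`ι[B.X] = [−1]`**: the inversion of the `k`-group scheme `B.X` is the endomorphism `(−1) • 𝟙` of the associated abelian variety
(`(𝟙)^{−1} = 𝟙 ≫ ι` in Mathlib's group `(B.X ⟶ B.X)`; ★ `AbelianVariety.hom_zsmul_id`). [cite: GortzWedhorn2023, Rem. 27.18 (3)–(4)] -/
theorem inv_eq_hom_neg_one_zsmul_one :
    (ι[B.X] : B.X ⟶ B.X) = ((-1 : ℤ) • 𝟙 B.toAffine.toAbelianVariety).hom.hom.hom := by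
  rw [AbelianVariety.hom_zsmul_id, zpow_neg_one]
  change ι[B.X] = (𝟙 B.X)⁻¹
  rw [Hom.inv_def, Category.id_comp]

/-! ## §2 `ι^♯` on `1`-forms: `ι^♯ ω = −ω` for global forms, semilinearity, constants -/

/-- **`ι^♯ ω = −ω` for every GLOBAL `1`-form `ω ∈ Γ(B, Ω¹_{B/k})`** (★ `comap_zsmul_one_app_top` at `n := −1`; `Γ(ι_*Ω¹, ⊤) = Γ(Ω¹, ⊤)`
definitionally). [cite: MumfordAV1970, §4 (iv) (p. 42–43)] -/
theorem comap_inv_app_top (ω : Γ(cotangentSheaf B.X, ⊤)) :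
    (show Γ(cotangentSheaf B.X, ⊤) from (cotangentSheaf.comap (ι[B.X] : B.X ⟶ B.X)).app ⊤ ω) = -ω := by
  have h := AbelianVariety.comap_zsmul_one_app_top (A := B.toAffine.toAbelianVariety) (-1) ω
  rw [← inv_eq_hom_neg_one_zsmul_one] at h
  rw [neg_one_zsmul] at h
  exact h

/-- **Cochain form**: `ι^♯(ω|_W) = −ω|_{ι⁻¹W}` for a global `1`-form `ω` and every open `W`. [cite: MumfordAV1970, §4 (iv) (p. 42–43)] -/
theorem comap_inv_app_map (ω : Γ(cotangentSheaf B.X, ⊤)) (W : B.X.left.Opens) :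
    (cotangentSheaf.comap (ι[B.X] : B.X ⟶ B.X)).app W
        ((cotangentSheaf B.X).presheaf.map (homOfLE (le_top : W ≤ ⊤)).op ω) =
      -(cotangentSheaf B.X).presheaf.map (homOfLE (le_top : (ι[B.X]).left ⁻¹ᵁ W ≤ ⊤)).op ω := by
  rw [AbelianVariety.app_map_apply, Scheme.Modules.pushforward_obj_presheaf_map]
  have h := comap_inv_app_top B ω
  change (cotangentSheaf.comap (ι[B.X] : B.X ⟶ B.X)).app ⊤ ω = -ω at h
  change (cotangentSheaf B.X).presheaf.map _ ((cotangentSheaf.comap (ι[B.X] : B.X ⟶ B.X)).app ⊤ ω) = _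
  rw [h]
  exact map_neg ((cotangentSheaf B.X).presheaf.map _).hom ω

/-- `ι^♯` is `𝒪`-semilinear along `ι♯`: `ι^♯(a • ω) = ι♯(a) • ι^♯(ω)` (a morphism into the push-forward `ι_*Ω¹`).
[cite: Hartshorne1977, II Prop. 8.11] -/
theorem comap_inv_app_smul (W : B.X.left.Opens) (a : Γ(B.X.left, W)) (ω : Γ(cotangentSheaf B.X, W)) :
    (show Γ(cotangentSheaf B.X, (ι[B.X]).left ⁻¹ᵁ W) from (cotangentSheaf.comap (ι[B.X] : B.X ⟶ B.X)).app W (a • ω)) =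
      (ι[B.X]).left.app W a • (show Γ(cotangentSheaf B.X, (ι[B.X]).left ⁻¹ᵁ W) from
        (cotangentSheaf.comap (ι[B.X] : B.X ⟶ B.X)).app W ω) := by
  rw [Scheme.Modules.Hom.app_smul]
  rfl

/-- `ι♯` fixes the constants: `ι♯(c|_W) = c|_{ι⁻¹W}` for `c ∈ k` (`ι` is a morphism over `Spec k`; ★ `appLE_constToPresheaf`).
[cite: Hartshorne1977, II Prop. 8.11 (morphisms of S-schemes)] -/
theorem app_inv_constToPresheaf (W : B.X.left.Opens) (c : k) :
    (ι[B.X]).left.app W ((constToPresheaf B.X).app (op W) c) = (constToPresheaf B.X).app (op ((ι[B.X]).left ⁻¹ᵁ W)) c := by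
  rw [Scheme.Hom.app_eq_appLE]
  exact appLE_constToPresheaf (ι[B.X] : B.X ⟶ B.X) W ((ι[B.X]).left ⁻¹ᵁ W) le_rfl c

/-! ## §3 Values of a GLOBAL vector field: restriction and constancy -/

/-- Values of a global field commute with restriction: `θ|_W(s|_W) = (θ(s))|_W` for `θ ∈ Γ(B, 𝒯)`, `s ∈ Γ(B, Ω¹)`.
[cite: Hartshorne1977, II.8 (p. 180)] -/
theorem appLE_map_top (θ : Γ(tangentSheaf B.X, ⊤)) (W : B.X.left.Opens) (s : Γ(cotangentSheaf B.X, ⊤)) :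
    appLE ((tangentSheaf B.X).presheaf.map (homOfLE (le_top : W ≤ ⊤)).op θ) (𝟙 _)
        ((cotangentSheaf B.X).presheaf.map (homOfLE (le_top : W ≤ ⊤)).op s) =
      (unitModule B.X.left).presheaf.map (homOfLE (le_top : W ≤ ⊤)).op (appLE θ (𝟙 _) s) := by
  rw [← appLE_map θ (𝟙 _) (homOfLE (le_top : W ≤ ⊤)) s]
  exact appLE_congr_hom θ _ _ _

/-- **`θ(ω)` is a CONSTANT** for a global field `θ` and a global `1`-form `ω`: `Γ(B, 𝒪_B) = k` (`B` proper, geometrically integral;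
★ `exists_constToPresheaf_app_top_eq`). [cite: GortzWedhorn2020, Prop. 12.66 (p. 350)] [cite: MumfordAV1970, §4 (iii) (p. 42)] -/
theorem exists_appLE_eq_constToPresheaf (θ : Γ(tangentSheaf B.X, ⊤)) (s : Γ(cotangentSheaf B.X, ⊤)) :
    ∃ c : k, (constToPresheaf B.X).app (op ⊤) c = (appLE θ (𝟙 _) s : Γ(B.X.left, ⊤)) :=
  AbelianVariety.exists_constToPresheaf_app_top_eq (A := B.toAffine.toAbelianVariety) _

/-- Constants restrict to constants (★ `AbelianVariety.map_constToPresheaf_app`, in the `B.X` carrier). [cite: GortzWedhorn2020, Prop. 12.66 (p. 350)] -/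
theorem map_constToPresheaf_app {U V : B.X.left.Opens} (i : V ⟶ U) (c : k) :
    B.X.left.presheaf.map i.op ((constToPresheaf B.X).app (op U) c) = (constToPresheaf B.X).app (op V) c :=
  AbelianVariety.map_constToPresheaf_app (A := B.toAffine.toAbelianVariety) i c

/-! ## §4 The head -/

/-- **(O2) Inversion negates global vector fields.**  For a global section `θ` of the tangent sheaf `𝒯_{B/k}` of an abelian
scheme `B` over a field, an open `W ⊆ B` and `c ∈ Γ(B, W)`:  `θ|_{ι⁻¹W}(d(ι♯ c)) = −ι♯(θ|_W(dc))`, `ι = ι[B.X]` the inversion.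
[cite: Oort1971, §2.2 (pp. 277–280)] [cite: GortzWedhorn2023, Rem. 27.18 (3)–(4)] -/
theorem appLE_dSection_app_inv_eq_neg (θ : Γ(tangentSheaf B.X, ⊤)) (W : B.X.left.Opens) (c : Γ(B.X.left, W)) :
    (show Γ(B.X.left, ι[B.X].left ⁻¹ᵁ W) from
      appLE ((tangentSheaf B.X).presheaf.map (homOfLE (le_top : ι[B.X].left ⁻¹ᵁ W ≤ ⊤)).op θ) (𝟙 _)
        (dSection B.X (ι[B.X].left ⁻¹ᵁ W) (ι[B.X].left.app W c))) =
    - ι[B.X].left.app W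
        (show Γ(B.X.left, W) from
          appLE ((tangentSheaf B.X).presheaf.map (homOfLE (le_top : W ≤ ⊤)).op θ) (𝟙 _) (dSection B.X W c)) := by
  classical
  -- the global coframe `ωⱼ` of `Ω¹_B ≅ 𝒪^{dim}` ([MumfordAV1970] §4 (iii)) and the coordinates `aⱼ` of `d c`
  obtain ⟨eΩ⟩ := AbelianVariety.nonempty_cotangentSheaf_iso_free_fin B.toAffine.toAbelianVariety
  set Ω := cotangentSheaf B.X with hΩ
  set ι₀ : B.X ⟶ B.X := ι[B.X] with hι₀
  set W' : B.X.left.Opens := ι₀.left ⁻¹ᵁ W with hW'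
  set ω : Fin B.toAffine.toAbelianVariety.dim → Γ(Ω, ⊤) := fun j => frameVec B.X.hom eΩ j with hω
  set a : Fin B.toAffine.toAbelianVariety.dim → Γ(B.X.left, W) := fun j =>
    (MSections.app B.X.hom (frameProj eΩ j) W (dSection B.X W c) : Γ(B.X.left, W)) with ha
  -- the constants `θ(ωⱼ) = cⱼ`
  have hconst : ∀ j, ∃ cj : k, (constToPresheaf B.X).app (op ⊤) cj = (appLE θ (𝟙 _) (ω j) : Γ(B.X.left, ⊤)) :=
    fun j => exists_appLE_eq_constToPresheaf B θ (ω j)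
  choose cst hcst using hconst
  -- (a) `d c = ∑ⱼ aⱼ • ωⱼ|_W`
  have hdc : dSection B.X W c = ∑ j, a j • Ω.presheaf.map (homOfLE (le_top : W ≤ ⊤)).op (ω j) :=
    eq_sum_frameProj_smul_frameVec B.X.hom eΩ W (dSection B.X W c)
  -- (b) `d(ι♯ c) = ι^♯(d c) = −∑ⱼ ι♯(aⱼ) • ωⱼ|_{W'}`
  have hdιc : dSection B.X W' (ι₀.left.app W c) =
      ∑ j, ι₀.left.app W (a j) • -Ω.presheaf.map (homOfLE (le_top : W' ≤ ⊤)).op (ω j) := by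
    rw [← comap_app_dSection ι₀ W c, hdc, map_sum]
    refine Finset.sum_congr rfl fun j _ => ?_
    change (show Γ(Ω, W') from (cotangentSheaf.comap ι₀).app W (a j • Ω.presheaf.map (homOfLE (le_top : W ≤ ⊤)).op (ω j))) = _
    rw [comap_inv_app_smul]
    congr 1
    exact comap_inv_app_map B (ω j) W
  -- (c) LHS `= −∑ⱼ ι♯(aⱼ) · cⱼ`
  have hL : (show Γ(B.X.left, W') from
      appLE ((tangentSheaf B.X).presheaf.map (homOfLE (le_top : W' ≤ ⊤)).op θ) (𝟙 _) (dSection B.X W' (ι₀.left.app W c))) =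
      -∑ j, ι₀.left.app W (a j) * (constToPresheaf B.X).app (op W') (cst j) := by
    rw [hdιc, appLE_def, map_sum, ← Finset.sum_neg_distrib]
    refine Finset.sum_congr rfl fun j _ => ?_
    rw [← appLE_def, appLE_smul_right, appLE_def, map_neg, ← appLE_def, appLE_map_top, ← hcst j, smul_neg]
    congr 1
    change ι₀.left.app W (a j) * (B.X.left.presheaf.map (homOfLE (le_top : W' ≤ ⊤)).op ((constToPresheaf B.X).app (op ⊤) (cst j))) = _
    rw [map_constToPresheaf_app B]
  -- (d) RHS `= −∑ⱼ ι♯(aⱼ) · cⱼ`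
  have hR : ι₀.left.app W (show Γ(B.X.left, W) from
      appLE ((tangentSheaf B.X).presheaf.map (homOfLE (le_top : W ≤ ⊤)).op θ) (𝟙 _) (dSection B.X W c)) =
      ∑ j, ι₀.left.app W (a j) * (constToPresheaf B.X).app (op W') (cst j) := by
    rw [hdc, appLE_def, map_sum, map_sum]
    refine Finset.sum_congr rfl fun j _ => ?_
    rw [← appLE_def, appLE_smul_right, appLE_map_top, ← hcst j]
    change ι₀.left.app W (a j * B.X.left.presheaf.map (homOfLE (le_top : W ≤ ⊤)).op ((constToPresheaf B.X).app (op ⊤) (cst j))) = _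
    rw [map_mul, map_constToPresheaf_app B, app_inv_constToPresheaf]
  rw [hL, hR]

end Literature.AlgebraicGeometry.AbelianSchemes.AbelianSchemeOver

end
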